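import Literature.Analysis.PDE.FreeFlowSlabSmooth
import Literature.Analysis.PDE.SobolevEnergy
import Mathlib.MeasureTheory.Function.Jacobian
import Mathlib.Analysis.Calculus.ContDiff.Bounds
import Mathlib.Algebra.Order.Chebyshev
import HarnessLib

/-!
# Sobolev energies under cutoff and transport by a local diffeomorphism (topic `Analysis/PDE`)

Analytic layer of the programme to prove short-time existence for quasilinear strictly
parabolic systems on a closed manifold (hypothesis `hQL` of
`Literature.Geometry.Riemannian.ricciFlow_shortTime_existence_of_quasilinear`). In the
parametrix on a closed manifold the lower-order error of one patch is re-localised into the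
other patches: a function `f` given in the coordinates of patch `κ'` appears in patch `κ` as
`y ↦ ρ̂(y) f(τ(y))` with the transition map `τ` and a bump `ρ̂`. This file bounds the Sobolev
energies of such transported functions,

* `sobolevEnergy_smul_comp_le` — for `τ` smooth with invertible derivative and injective on an
  open set `V`, a compact `K ⊆ V`, and a smooth `ρ̂` with `tsupport ρ̂ ⊆ K`, for every `k`
  there is `C < ∞` with `E_k(y ↦ ρ̂(y) • f(τ y)) ≤ C · E_k(f)` for all smooth `f`
  (the constant depends on `k`, `dim E`, `ρ̂`, the derivatives of `τ` on `K` and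
  `inf_K |det Dτ|`, not on `f`),

through two comparisons of independent use (`E_k` versus the `L²` norms of the full iterated
Fréchet derivatives),

* `sobolevEnergy_le_mul_sum_lintegral_iteratedFDeriv` — `E_k(h) ≤ N Σ_{i ≤ k} ∫‖Dⁱh‖²`,
* `lintegral_iteratedFDeriv_le_mul_sobolevEnergy` — `∫‖Dⁱh‖² ≤ N' E_i(h)`
  (operator norm through basis tuples, `ContinuousMultilinearMap.norm_le_sum_norm_apply_basis`),

Mathlib's bounds for iterated derivatives of products and compositions
(`norm_iteratedFDerivWithin_smul_le`, `norm_iteratedFDerivWithin_comp_le`), and the change of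
variables formula `lintegral_image_eq_lintegral_abs_det_fderiv_mul`.

Everything is proved; no named fact and no `sorry` is introduced.

## References

* R. A. Adams, *Sobolev Spaces*, Academic Press 1975, Thm. 3.35 (`W^{m,p}` is invariant under
  `C^m`-diffeomorphisms with bounded derivatives, with norm equivalence). [Adams1975]
-/

noncomputable section

open MeasureTheory Set Function Filter Topology
open scoped ENNReal ContDiff Nat

namespace Literature.Analysis.PDE

open Literature.Analysis.FunctionSpaces

variable {E : Type*} [NormedAddCommGroup E] [InnerProductSpace ℝ E] [FiniteDimensional ℝ E]
  [MeasurableSpace E] [BorelSpace E]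
variable {F : Type*} [NormedAddCommGroup F] [NormedSpace ℝ F]

/-! ### `E_k` versus the `L²` norms of the full iterated derivatives -/

section Comparison

omit [FiniteDimensional ℝ E] [MeasurableSpace E] [BorelSpace E] in
/-- `‖Dⁱ(∂ᵥh)(x)‖ ≤ ‖v‖ ‖Dⁱ⁺¹h(x)‖`: a directional derivative inside costs one full order.
[folklore] -/
theorem norm_iteratedFDeriv_fderiv_apply_le {h : E → F} (hh : ContDiff ℝ ∞ h) (i : ℕ) (v : E)
    (x : E) :
    ‖iteratedFDeriv ℝ i (fun y ↦ fderiv ℝ h y v) x‖ ≤ ‖v‖ * ‖iteratedFDeriv ℝ (i + 1) h x‖ := by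
  have heq : (fun y ↦ fderiv ℝ h y v) = (ContinuousLinearMap.apply ℝ F v) ∘ fderiv ℝ h := rfl
  rw [heq, ContinuousLinearMap.iteratedFDeriv_comp_left _
    ((hh.fderiv_right (m := ∞) (by norm_cast)).contDiffAt) (by exact_mod_cast le_top)]
  calc ‖(ContinuousLinearMap.apply ℝ F v).compContinuousMultilinearMap (iteratedFDeriv ℝ i (fderiv ℝ h) x)‖
      ≤ ‖ContinuousLinearMap.apply ℝ F v‖ * ‖iteratedFDeriv ℝ i (fderiv ℝ h) x‖ :=
        ContinuousLinearMap.norm_compContinuousMultilinearMap_le _ _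
    _ ≤ ‖v‖ * ‖iteratedFDeriv ℝ (i + 1) h x‖ := by
        rw [norm_iteratedFDeriv_fderiv]
        refine mul_le_mul_of_nonneg_right ?_ (norm_nonneg _)
        refine ContinuousLinearMap.opNorm_le_bound _ (norm_nonneg v) fun L ↦ ?_
        rw [ContinuousLinearMap.apply_apply, mul_comm]
        exact L.le_opNorm v

/-- **`E_k` is controlled by the full iterated derivatives**: for every `k` there is `N < ∞`
(depending on `k` and `dim E`) with `E_k(h) ≤ N Σ_{i ≤ k} ∫ ‖Dⁱh‖²` for smooth `h`.
[cite: Adams1975, Thm. 3.35] -/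
theorem sobolevEnergy_le_mul_sum_lintegral_iteratedFDeriv (k : ℕ) :
    ∃ N : ℝ≥0∞, N ≠ ⊤ ∧ ∀ {h : E → F}, ContDiff ℝ ∞ h →
      sobolevEnergy k h ≤ N * ∑ i ∈ Finset.range (k + 1), ∫⁻ x, ‖iteratedFDeriv ℝ i h x‖ₑ ^ 2 := by
  induction k with
  | zero =>
    refine ⟨1, ENNReal.one_ne_top, fun {h} _ ↦ ?_⟩
    simp [sobolevEnergy_zero_left, norm_iteratedFDeriv_zero, ← ofReal_norm]
  | succ k ih =>
    obtain ⟨N, hNtop, hN⟩ := ih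
    set n : ℝ≥0∞ := (Module.finrank ℝ E : ℝ≥0∞) with hn
    refine ⟨1 + n * N, ENNReal.add_ne_top.2 ⟨ENNReal.one_ne_top, ENNReal.mul_ne_top
      (by rw [hn]; exact ENNReal.natCast_ne_top _) hNtop⟩, fun {h} hh ↦ ?_⟩
    set b := stdOrthonormalBasis ℝ E
    have hhi : ∀ j, ContDiff ℝ ∞ fun y ↦ fderiv ℝ h y (b j) := fun j ↦
      (hh.fderiv_right (m := ∞) (by norm_cast)).clm_apply contDiff_const
    -- each `E_k(∂ⱼh) ≤ N Σᵢ ∫‖Dⁱ(∂ⱼh)‖² ≤ N Σᵢ ∫‖Dⁱ⁺¹h‖²`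
    have hstep : ∀ j, sobolevEnergy k (fun y ↦ fderiv ℝ h y (b j)) ≤
        N * ∑ i ∈ Finset.range (k + 1), ∫⁻ x, ‖iteratedFDeriv ℝ (i + 1) h x‖ₑ ^ 2 := by
      intro j
      refine (hN (hhi j)).trans (mul_le_mul' le_rfl (Finset.sum_le_sum fun i _ ↦ ?_))
      refine lintegral_mono fun x ↦ ?_
      have h1 := norm_iteratedFDeriv_fderiv_apply_le hh i (b j) x
      rw [b.orthonormal.1 j, one_mul] at h1
      exact pow_le_pow_left' (by
        rw [← ofReal_norm, ← ofReal_norm]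
        exact ENNReal.ofReal_le_ofReal h1) 2
    rw [sobolevEnergy_succ]
    calc (∫⁻ x, ‖h x‖ₑ ^ 2) + ∑ j, sobolevEnergy k (fun y ↦ fderiv ℝ h y (b j))
        ≤ (∫⁻ x, ‖iteratedFDeriv ℝ 0 h x‖ₑ ^ 2) +
            ∑ j : Fin (Module.finrank ℝ E), N * ∑ i ∈ Finset.range (k + 1),
              ∫⁻ x, ‖iteratedFDeriv ℝ (i + 1) h x‖ₑ ^ 2 := by
          refine add_le_add (le_of_eq ?_) (Finset.sum_le_sum fun j _ ↦ hstep j)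
          simp [norm_iteratedFDeriv_zero, ← ofReal_norm]
      _ = (∫⁻ x, ‖iteratedFDeriv ℝ 0 h x‖ₑ ^ 2) +
            n * N * ∑ i ∈ Finset.range (k + 1), ∫⁻ x, ‖iteratedFDeriv ℝ (i + 1) h x‖ₑ ^ 2 := by
          rw [Finset.sum_const, Finset.card_univ, Fintype.card_fin, nsmul_eq_mul, hn, mul_assoc]
      _ ≤ (1 + n * N) * ∑ i ∈ Finset.range (k + 1 + 1), ∫⁻ x, ‖iteratedFDeriv ℝ i h x‖ₑ ^ 2 := by
          rw [add_mul, one_mul, Finset.sum_range_succ' _ (k + 1)]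
          refine add_le_add ?_ ?_
          · exact le_add_self
          · refine mul_le_mul' le_rfl ?_
            exact le_self_add

/-- The `L²` norm of a word derivative of length `i` over the standard frame is controlled by
`E_i`. [cite: Adams1975, ¶3.1] -/
theorem lintegral_iterDirDeriv_ofFn_sq_le_sobolevEnergy :
    ∀ (i : ℕ) (h : E → F) (idx : Fin i → Fin (Module.finrank ℝ E)),
      ∫⁻ x, ‖iterDirDeriv (List.ofFn fun l ↦ stdOrthonormalBasis ℝ E (idx l)) h x‖ₑ ^ 2 ≤
        sobolevEnergy i h
  | 0, h, idx => by simp [sobolevEnergy_zero_left]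
  | i + 1, h, idx => by
    set b := stdOrthonormalBasis ℝ E
    -- split the word as `init ++ [last]`: the innermost derivative is `∂_{last}`
    rw [List.ofFn_succ', List.concat_eq_append, iterDirDeriv_append_singleton]
    refine (lintegral_iterDirDeriv_ofFn_sq_le_sobolevEnergy i (fun x ↦ fderiv ℝ h x (b (idx (Fin.last i))))
      (fun l ↦ idx (Fin.castSucc l))).trans ?_
    rw [sobolevEnergy_succ]
    refine le_trans ?_ le_add_self
    exact Finset.single_le_sum (f := fun j ↦ sobolevEnergy i fun x ↦ fderiv ℝ h x (b j))
      (fun j _ ↦ bot_le) (Finset.mem_univ _)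

/-- **The full iterated derivatives are controlled by `E_i`**: there is `N' < ∞` (depending on
`i` and `dim E`) with `∫ ‖Dⁱh‖² ≤ N' E_i(h)` for smooth `h` (operator norms through basis tuples).
[cite: Adams1975, Thm. 3.35] -/
theorem lintegral_iteratedFDeriv_le_mul_sobolevEnergy (i : ℕ) :
    ∃ N' : ℝ≥0∞, N' ≠ ⊤ ∧ ∀ {h : E → F}, ContDiff ℝ ∞ h →
      ∫⁻ x, ‖iteratedFDeriv ℝ i h x‖ₑ ^ 2 ≤ N' * sobolevEnergy i h := by
  classical
  set b := stdOrthonormalBasis ℝ E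
  set m : ℕ := Fintype.card (Fin i → Fin (Module.finrank ℝ E)) with hm
  refine ⟨(m : ℝ≥0∞) * m, ENNReal.mul_ne_top (ENNReal.natCast_ne_top _) (ENNReal.natCast_ne_top _),
    fun {h} hh ↦ ?_⟩
  -- pointwise: `‖Dⁱh(x)‖² ≤ m Σ_idx ‖∂_{idx}h(x)‖²`
  have hpt : ∀ x, ‖iteratedFDeriv ℝ i h x‖ₑ ^ 2 ≤
      (m : ℝ≥0∞) * ∑ idx : Fin i → Fin (Module.finrank ℝ E),
        ‖iterDirDeriv (List.ofFn fun l ↦ b (idx l)) h x‖ₑ ^ 2 := by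
    intro x
    have h1 := ContinuousMultilinearMap.norm_le_sum_norm_apply_basis (iteratedFDeriv ℝ i h x)
    have h2 : ‖iteratedFDeriv ℝ i h x‖ ^ 2 ≤ m * ∑ idx : Fin i → Fin (Module.finrank ℝ E),
        ‖iteratedFDeriv ℝ i h x (fun l ↦ b (idx l))‖ ^ 2 := by
      refine (pow_le_pow_left₀ (norm_nonneg _) h1 2).trans ?_
      have h := sq_sum_le_card_mul_sum_sq (s := Finset.univ)
        (f := fun idx : Fin i → Fin (Module.finrank ℝ E) ↦ ‖iteratedFDeriv ℝ i h x (fun l ↦ b (idx l))‖)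
      rw [Finset.card_univ] at h
      exact h
    have h3 : ‖iteratedFDeriv ℝ i h x‖ₑ ^ 2 = ENNReal.ofReal (‖iteratedFDeriv ℝ i h x‖ ^ 2) := by
      rw [← ofReal_norm, ENNReal.ofReal_pow (norm_nonneg _)]
    rw [h3]
    refine (ENNReal.ofReal_le_ofReal h2).trans (le_of_eq ?_)
    rw [ENNReal.ofReal_mul (by positivity), ENNReal.ofReal_natCast,
      ENNReal.ofReal_sum_of_nonneg (fun _ _ ↦ sq_nonneg _)]
    congr 1
    refine Finset.sum_congr rfl fun idx _ ↦ ?_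
    rw [iteratedFDeriv_apply_eq_iterDirDeriv_ofFn hh, ← ofReal_norm, ENNReal.ofReal_pow (norm_nonneg _)]
  have hmeas : ∀ idx : Fin i → Fin (Module.finrank ℝ E),
      Measurable fun x ↦ ‖iterDirDeriv (List.ofFn fun l ↦ b (idx l)) h x‖ₑ ^ 2 := fun idx ↦
    (continuous_enorm.comp (contDiff_iterDirDeriv hh _).continuous).measurable.pow_const 2
  calc ∫⁻ x, ‖iteratedFDeriv ℝ i h x‖ₑ ^ 2
      ≤ ∫⁻ x, (m : ℝ≥0∞) * ∑ idx : Fin i → Fin (Module.finrank ℝ E),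
          ‖iterDirDeriv (List.ofFn fun l ↦ b (idx l)) h x‖ₑ ^ 2 := lintegral_mono hpt
    _ = (m : ℝ≥0∞) * ∑ idx : Fin i → Fin (Module.finrank ℝ E),
          ∫⁻ x, ‖iterDirDeriv (List.ofFn fun l ↦ b (idx l)) h x‖ₑ ^ 2 := by
        rw [lintegral_const_mul _ (Finset.measurable_sum _ fun idx _ ↦ hmeas idx),
          lintegral_finsetSum _ fun idx _ ↦ hmeas idx]
    _ ≤ (m : ℝ≥0∞) * ∑ _idx : Fin i → Fin (Module.finrank ℝ E), sobolevEnergy i h :=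
        mul_le_mul' le_rfl (Finset.sum_le_sum fun idx _ ↦ lintegral_iterDirDeriv_ofFn_sq_le_sobolevEnergy i h idx)
    _ = (m : ℝ≥0∞) * m * sobolevEnergy i h := by
        rw [Finset.sum_const, Finset.card_univ, nsmul_eq_mul, hm, mul_assoc]

end Comparison

/-! ### Cutoff and transport by a local diffeomorphism -/

section Transport

variable {τ : E → E} {V K : Set E} {ρ : E → ℝ}

omit [InnerProductSpace ℝ E] [FiniteDimensional ℝ E] [MeasurableSpace E] [BorelSpace E] in
/-- The transported cut-off function `y ↦ ρ(y) • f(τ y)` is smooth on the whole space when `ρ`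
is smooth with support inside a compact `K ⊆ V`, `V` open, and `τ`, `f` are smooth on `V`,
everywhere. [folklore] -/
theorem contDiff_smul_comp_of_tsupport_subset [NormedSpace ℝ E] (hV : IsOpen V)
    (hτ : ContDiffOn ℝ ∞ τ V) (hKV : K ⊆ V) (hρ : ContDiff ℝ ∞ ρ) (hρK : tsupport ρ ⊆ K)
    {f : E → F} (hf : ContDiff ℝ ∞ f) : ContDiff ℝ ∞ fun y ↦ ρ y • f (τ y) := by
  refine contDiff_iff_contDiffAt.2 fun y ↦ ?_
  by_cases hy : y ∈ V
  · exact (hρ.contDiffOn.smul (hf.comp_contDiffOn hτ)).contDiffAt (hV.mem_nhds hy)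
  · -- off `V ⊇ K ⊇ tsupport ρ` the function vanishes near `y`
    have hy' : y ∉ tsupport ρ := fun h ↦ hy (hKV (hρK h))
    rw [notMem_tsupport_iff_eventuallyEq] at hy'
    have hev : (fun y ↦ ρ y • f (τ y)) =ᶠ[𝓝 y] fun _ ↦ 0 := by
      filter_upwards [hy'] with z hz
      simp [hz]
    exact (contDiffAt_const (c := (0 : F))).congr_of_eventuallyEq hev

omit [InnerProductSpace ℝ E] [FiniteDimensional ℝ E] [MeasurableSpace E] [BorelSpace E] in
/-- The transported cut-off function is supported in `tsupport ρ`. [folklore] -/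
theorem tsupport_smul_comp_subset [NormedSpace ℝ E] (ρ : E → ℝ) (f : E → F) (τ : E → E) :
    tsupport (fun y ↦ ρ y • f (τ y)) ⊆ tsupport ρ :=
  tsupport_smul_subset_left ρ fun y ↦ f (τ y)

omit [InnerProductSpace ℝ E] [FiniteDimensional ℝ E] [MeasurableSpace E] [BorelSpace E] in
/-- Off `K ⊇ tsupport ρ` all derivatives of the transported cut-off function vanish.
[folklore] -/
theorem iteratedFDeriv_smul_comp_eq_zero [NormedSpace ℝ E] (hρK : tsupport ρ ⊆ K) (f : E → F)
    (τ : E → E) (i : ℕ) {y : E} (hy : y ∉ K) :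
    iteratedFDeriv ℝ i (fun y ↦ ρ y • f (τ y)) y = 0 := by
  by_contra h
  exact hy (hρK (tsupport_smul_comp_subset ρ f τ (support_iteratedFDeriv_subset i h)))

omit [InnerProductSpace ℝ E] [FiniteDimensional ℝ E] [MeasurableSpace E] [BorelSpace E] in
/-- Uniform bounds for the derivatives of `τ` up to order `k` on a compact `K ⊆ V`.
[folklore] -/
theorem exists_bound_iteratedFDerivWithin_of_isCompact [NormedSpace ℝ E] {E' : Type*}
    [NormedAddCommGroup E'] [NormedSpace ℝ E'] {τ : E → E'} (hV : IsOpen V)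
    (hτ : ContDiffOn ℝ ∞ τ V) (hK : IsCompact K) (hKV : K ⊆ V) (k : ℕ) :
    ∃ D : ℝ, 1 ≤ D ∧ ∀ y ∈ K, ∀ i ≤ k, ‖iteratedFDerivWithin ℝ i τ V y‖ ≤ D := by
  have hb : ∀ i : ℕ, ∃ C : ℝ, ∀ y ∈ K, ‖iteratedFDerivWithin ℝ i τ V y‖ ≤ C := fun i ↦
    hK.exists_bound_of_continuousOn
      ((hτ.continuousOn_iteratedFDerivWithin (m := i) (by exact_mod_cast le_top)
        hV.uniqueDiffOn).mono hKV)
  choose C hC using hb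
  refine ⟨1 + ∑ i ∈ Finset.range (k + 1), |C i|, le_add_of_nonneg_right
    (Finset.sum_nonneg fun _ _ ↦ abs_nonneg _), fun y hy i hi ↦ ?_⟩
  calc ‖iteratedFDerivWithin ℝ i τ V y‖ ≤ C i := hC i y hy
    _ ≤ |C i| := le_abs_self _
    _ ≤ ∑ i ∈ Finset.range (k + 1), |C i| :=
        Finset.single_le_sum (f := fun i ↦ |C i|) (fun _ _ ↦ abs_nonneg _)
          (Finset.mem_range.2 (Nat.lt_succ_of_le hi))
    _ ≤ 1 + ∑ i ∈ Finset.range (k + 1), |C i| := le_add_of_nonneg_left zero_le_one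

omit [InnerProductSpace ℝ E] [FiniteDimensional ℝ E] [MeasurableSpace E] [BorelSpace E] in
/-- Uniform bounds for the derivatives up to order `k` of a smooth compactly supported
function. [folklore] -/
theorem exists_bound_iteratedFDeriv_of_hasCompactSupport [NormedSpace ℝ E] {G : Type*}
    [NormedAddCommGroup G] [NormedSpace ℝ G] {ρ : E → G} (hρ : ContDiff ℝ ∞ ρ)
    (hρc : HasCompactSupport ρ) (k : ℕ) :
    ∃ R : ℝ, 0 ≤ R ∧ ∀ y, ∀ i ≤ k, ‖iteratedFDeriv ℝ i ρ y‖ ≤ R := by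
  have hb : ∀ i : ℕ, ∃ C : ℝ, ∀ y, ‖iteratedFDeriv ℝ i ρ y‖ ≤ C := fun i ↦
    (hρ.continuous_iteratedFDeriv (m := i) (by exact_mod_cast le_top)).bounded_above_of_compact_support
      (hρc.iteratedFDeriv i)
  choose C hC using hb
  refine ⟨∑ i ∈ Finset.range (k + 1), |C i|, Finset.sum_nonneg fun _ _ ↦ abs_nonneg _,
    fun y i hi ↦ ?_⟩
  calc ‖iteratedFDeriv ℝ i ρ y‖ ≤ C i := hC i y
    _ ≤ |C i| := le_abs_self _
    _ ≤ ∑ i ∈ Finset.range (k + 1), |C i| :=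
        Finset.single_le_sum (f := fun i ↦ |C i|) (fun _ _ ↦ abs_nonneg _)
          (Finset.mem_range.2 (Nat.lt_succ_of_le hi))

omit [InnerProductSpace ℝ E] [FiniteDimensional ℝ E] [MeasurableSpace E] [BorelSpace E] in
/-- **Pointwise bound for the derivatives of the transported cut-off function**: on `K`,
`‖Dⁱ(ρ • (f ∘ τ))(y)‖ ≤ A Σ_{m ≤ i} ‖Dᵐf(τ y)‖` for all `i ≤ k` and all smooth `f`, with `A`
depending on `k`, `ρ` and the derivatives of `τ` on `K` (Leibniz and Faà di Bruno bounds,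
`norm_iteratedFDerivWithin_smul_le`, `norm_iteratedFDerivWithin_comp_le`).
[cite: Adams1975, Thm. 3.35] -/
theorem norm_iteratedFDeriv_smul_comp_le [NormedSpace ℝ E] (hV : IsOpen V)
    (hτ : ContDiffOn ℝ ∞ τ V) (hK : IsCompact K) (hKV : K ⊆ V) (hρ : ContDiff ℝ ∞ ρ)
    (hρK : tsupport ρ ⊆ K) (k : ℕ) :
    ∃ A : ℝ, 0 ≤ A ∧ ∀ {f : E → F}, ContDiff ℝ ∞ f → ∀ i ≤ k, ∀ y ∈ K,
      ‖iteratedFDeriv ℝ i (fun y ↦ ρ y • f (τ y)) y‖ ≤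
        A * ∑ m ∈ Finset.range (i + 1), ‖iteratedFDeriv ℝ m f (τ y)‖ := by
  obtain ⟨D, hD1, hD⟩ := exists_bound_iteratedFDerivWithin_of_isCompact hV hτ hK hKV k
  have hρc : HasCompactSupport ρ := hK.of_isClosed_subset (isClosed_tsupport _) hρK
  obtain ⟨R, hR0, hR⟩ := exists_bound_iteratedFDeriv_of_hasCompactSupport hρ hρc k
  have hD0 : 0 ≤ D := zero_le_one.trans hD1
  -- the constant: the sum over all orders `i ≤ k` of the Leibniz--Faà di Bruno coefficients
  set A : ℕ → ℝ := fun i ↦ ∑ j ∈ Finset.range (i + 1), (i.choose j : ℝ) * R * ((i - j)! * D ^ (i - j))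
    with hA
  have hAnn : ∀ i, 0 ≤ A i := fun i ↦ Finset.sum_nonneg fun j _ ↦ by positivity
  refine ⟨∑ i ∈ Finset.range (k + 1), A i, Finset.sum_nonneg fun i _ ↦ hAnn i,
    fun {f} hf i hi y hy ↦ ?_⟩
  have hyV : y ∈ V := hKV hy
  set Cf : ℝ := ∑ m ∈ Finset.range (i + 1), ‖iteratedFDeriv ℝ m f (τ y)‖ with hCf
  have hCf0 : 0 ≤ Cf := Finset.sum_nonneg fun _ _ ↦ norm_nonneg _
  have hfτ : ContDiffOn ℝ ∞ (fun y ↦ f (τ y)) V := hf.comp_contDiffOn hτ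
  rw [← iteratedFDerivWithin_of_isOpen i hV hyV]
  -- Leibniz
  refine (norm_iteratedFDerivWithin_smul_le hρ.contDiffOn hfτ hV.uniqueDiffOn hyV
    (n := i) (by exact_mod_cast le_top)).trans ?_
  -- Faà di Bruno on each term
  have hcomp : ∀ l ≤ i, ‖iteratedFDerivWithin ℝ l (fun y ↦ f (τ y)) V y‖ ≤ l ! * Cf * D ^ l := by
    intro l hl
    have h := norm_iteratedFDerivWithin_comp_le (g := f) (f := τ) (n := l) (N := ∞) (t := univ)
      hf.contDiffOn hτ (by exact_mod_cast le_top) uniqueDiffOn_univ hV.uniqueDiffOn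
      (mapsTo_univ _ _) hyV (C := Cf) (D := D) (fun m hm ↦ ?_) (fun m hm1 hml ↦ ?_)
    · exact h
    · rw [iteratedFDerivWithin_univ]
      exact Finset.single_le_sum (f := fun m ↦ ‖iteratedFDeriv ℝ m f (τ y)‖)
        (fun _ _ ↦ norm_nonneg _) (Finset.mem_range.2 (by omega))
    · exact (hD y hy m (by omega)).trans (le_self_pow₀ hD1 (by omega))
  have hρj : ∀ j ≤ i, ‖iteratedFDerivWithin ℝ j ρ V y‖ ≤ R := by
    intro j hj
    rw [iteratedFDerivWithin_of_isOpen j hV hyV]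
    exact hR y j (hj.trans hi)
  calc ∑ j ∈ Finset.range (i + 1), (i.choose j : ℝ) * ‖iteratedFDerivWithin ℝ j ρ V y‖ *
        ‖iteratedFDerivWithin ℝ (i - j) (fun y ↦ f (τ y)) V y‖
      ≤ ∑ j ∈ Finset.range (i + 1), (i.choose j : ℝ) * R * ((i - j)! * Cf * D ^ (i - j)) := by
        refine Finset.sum_le_sum fun j hj ↦ ?_
        have hji : j ≤ i := Nat.lt_succ_iff.1 (Finset.mem_range.1 hj)
        refine mul_le_mul (mul_le_mul_of_nonneg_left (hρj j hji) (by positivity))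
          (hcomp (i - j) (Nat.sub_le _ _)) (norm_nonneg _) (by positivity)
    _ = A i * Cf := by
        rw [hA, Finset.sum_mul]
        refine Finset.sum_congr rfl fun j _ ↦ ?_
        ring
    _ ≤ (∑ i ∈ Finset.range (k + 1), A i) * Cf := by
        refine mul_le_mul_of_nonneg_right ?_ hCf0
        exact Finset.single_le_sum (f := A) (fun i _ ↦ hAnn i)
          (Finset.mem_range.2 (Nat.lt_succ_of_le hi))

omit [FiniteDimensional ℝ E] [MeasurableSpace E] [BorelSpace E] in
/-- A positive lower bound for `|det Dτ|` on a compact set on which it does not vanish.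
[folklore] -/
theorem exists_pos_le_abs_det_fderiv (hV : IsOpen V) (hτ : ContDiffOn ℝ ∞ τ V)
    (hdet : ∀ y ∈ V, (fderiv ℝ τ y).det ≠ 0) (hK : IsCompact K) (hKV : K ⊆ V) :
    ∃ c : ℝ, 0 < c ∧ ∀ y ∈ K, c ≤ |(fderiv ℝ τ y).det| := by
  rcases K.eq_empty_or_nonempty with rfl | hne
  · exact ⟨1, one_pos, fun y hy ↦ hy.elim⟩
  have hcont : ContinuousOn (fun y ↦ |(fderiv ℝ τ y).det|) K := by
    refine (continuous_abs.comp_continuousOn ?_)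
    exact (ContinuousLinearMap.continuous_det.comp_continuousOn
      (hτ.continuousOn_fderiv_of_isOpen hV (by exact_mod_cast le_top))).mono hKV
  obtain ⟨y₀, hy₀, hmin⟩ := hK.exists_isMinOn hne hcont
  exact ⟨|(fderiv ℝ τ y₀).det|, abs_pos.2 (hdet y₀ (hKV hy₀)), fun y hy ↦ hmin hy⟩

/-- **Change of variables on a compact set**: if `τ` is smooth and injective on an open `V`
with `det Dτ ≠ 0`, then for a compact `K ⊆ V` there is `c < ∞` with
`∫_K φ(τ y) dy ≤ c ∫ φ` for every `φ ≥ 0` (`lintegral_image_eq_lintegral_abs_det_fderiv_mul`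
and `inf_K |det Dτ| > 0`). [cite: Adams1975, Thm. 3.35] -/
theorem exists_setLIntegral_comp_le (hV : IsOpen V) (hτ : ContDiffOn ℝ ∞ τ V) (hinj : InjOn τ V)
    (hdet : ∀ y ∈ V, (fderiv ℝ τ y).det ≠ 0) (hK : IsCompact K) (hKV : K ⊆ V) :
    ∃ c : ℝ≥0∞, c ≠ ⊤ ∧ ∀ g : E → ℝ≥0∞, ∫⁻ y in K, g (τ y) ≤ c * ∫⁻ x, g x := by
  obtain ⟨c₀, hc₀, hc₀le⟩ := exists_pos_le_abs_det_fderiv hV hτ hdet hK hKV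
  refine ⟨ENNReal.ofReal c₀⁻¹, ENNReal.ofReal_ne_top, fun g ↦ ?_⟩
  have hderiv : ∀ y ∈ K, HasFDerivWithinAt τ (fderiv ℝ τ y) K y := fun y hy ↦
    (((hτ y (hKV hy)).contDiffAt (hV.mem_nhds (hKV hy))).differentiableAt
      (by simp)).hasFDerivAt.hasFDerivWithinAt
  calc ∫⁻ y in K, g (τ y)
      ≤ ∫⁻ y in K, ENNReal.ofReal c₀⁻¹ * (ENNReal.ofReal |(fderiv ℝ τ y).det| * g (τ y)) := by
        refine setLIntegral_mono' hK.measurableSet fun y hy ↦ ?_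
        rw [← mul_assoc, ← ENNReal.ofReal_mul (inv_nonneg.2 hc₀.le)]
        refine le_mul_of_one_le_left bot_le ?_
        rw [← ENNReal.ofReal_one]
        refine ENNReal.ofReal_le_ofReal ?_
        rw [← inv_mul_cancel₀ hc₀.ne']
        exact mul_le_mul_of_nonneg_left (hc₀le y hy) (inv_nonneg.2 hc₀.le)
    _ = ENNReal.ofReal c₀⁻¹ * ∫⁻ x in τ '' K, g x := by
        rw [lintegral_const_mul' _ _ ENNReal.ofReal_ne_top,
          lintegral_image_eq_lintegral_abs_det_fderiv_mul volume hK.measurableSet hderiv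
            (hinj.mono hKV)]
    _ ≤ ENNReal.ofReal c₀⁻¹ * ∫⁻ x, g x :=
        mul_le_mul' le_rfl (setLIntegral_le_lintegral _ _)

/-- **Sobolev energies under cutoff and transport** (invariance of `H^k` under
diffeomorphisms, quantitative on a compact set): let `τ` be smooth and injective on an open set
`V` with `det Dτ ≠ 0` there, `K ⊆ V` compact and `ρ` smooth with `tsupport ρ ⊆ K`. Then for
every `k` there is `C < ∞` with `E_k(y ↦ ρ(y) • f(τ y)) ≤ C E_k(f)` for all smooth `f`.
[cite: Adams1975, Thm. 3.35] -/
theorem sobolevEnergy_smul_comp_le (hV : IsOpen V) (hτ : ContDiffOn ℝ ∞ τ V) (hinj : InjOn τ V)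
    (hdet : ∀ y ∈ V, (fderiv ℝ τ y).det ≠ 0) (hK : IsCompact K) (hKV : K ⊆ V)
    (hρ : ContDiff ℝ ∞ ρ) (hρK : tsupport ρ ⊆ K) (k : ℕ) :
    ∃ C : ℝ≥0∞, C ≠ ⊤ ∧ ∀ {f : E → F}, ContDiff ℝ ∞ f →
      sobolevEnergy k (fun y ↦ ρ y • f (τ y)) ≤ C * sobolevEnergy k f := by
  classical
  obtain ⟨N, hNtop, hN⟩ := sobolevEnergy_le_mul_sum_lintegral_iteratedFDeriv (E := E) (F := F) k
  choose N' hN'top hN' using fun m ↦ lintegral_iteratedFDeriv_le_mul_sobolevEnergy (E := E) (F := F) m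
  obtain ⟨A, hA0, hA⟩ := norm_iteratedFDeriv_smul_comp_le (F := F) hV hτ hK hKV hρ hρK k
  obtain ⟨c, hctop, hc⟩ := exists_setLIntegral_comp_le hV hτ hinj hdet hK hKV
  -- the constant
  set B : ℕ → ℝ≥0∞ := fun i ↦ ENNReal.ofReal (A ^ 2 * (i + 1)) *
    (c * ∑ m ∈ Finset.range (i + 1), N' m) with hB
  have hBtop : ∀ i, B i ≠ ⊤ := fun i ↦ ENNReal.mul_ne_top ENNReal.ofReal_ne_top
    (ENNReal.mul_ne_top hctop (ENNReal.sum_ne_top.2 fun m _ ↦ hN'top m))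
  refine ⟨N * ∑ i ∈ Finset.range (k + 1), B i, ENNReal.mul_ne_top hNtop
    (ENNReal.sum_ne_top.2 fun i _ ↦ hBtop i), fun {f} hf ↦ ?_⟩
  have hg : ContDiff ℝ ∞ fun y ↦ ρ y • f (τ y) :=
    contDiff_smul_comp_of_tsupport_subset hV hτ hKV hρ hρK hf
  -- the `L²` norm of `Dᵐ f`, summed over `m ≤ i`
  set Φ : ℕ → E → ℝ≥0∞ := fun i x ↦ ∑ m ∈ Finset.range (i + 1), ‖iteratedFDeriv ℝ m f x‖ₑ ^ 2
    with hΦ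
  have hΦmeas : ∀ m, Measurable fun x ↦ ‖iteratedFDeriv ℝ m f x‖ₑ ^ 2 := fun m ↦
    (continuous_enorm.comp (hf.continuous_iteratedFDeriv (m := m)
      (by exact_mod_cast le_top))).measurable.pow_const 2
  -- pointwise bound by the indicator of `K`
  have hpt : ∀ i ≤ k, ∀ y, ‖iteratedFDeriv ℝ i (fun y ↦ ρ y • f (τ y)) y‖ₑ ^ 2 ≤
      K.indicator (fun y ↦ ENNReal.ofReal (A ^ 2 * (i + 1)) * Φ i (τ y)) y := by
    intro i hi y
    by_cases hy : y ∈ K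
    · rw [indicator_of_mem hy]
      have h1 := hA hf i hi y hy
      have h2 : ‖iteratedFDeriv ℝ i (fun y ↦ ρ y • f (τ y)) y‖ ^ 2 ≤
          A ^ 2 * (i + 1) * ∑ m ∈ Finset.range (i + 1), ‖iteratedFDeriv ℝ m f (τ y)‖ ^ 2 := by
        refine (pow_le_pow_left₀ (norm_nonneg _) h1 2).trans ?_
        rw [mul_pow, mul_assoc]
        refine mul_le_mul_of_nonneg_left ?_ (sq_nonneg _)
        have h := sq_sum_le_card_mul_sum_sq (s := Finset.range (i + 1))
          (f := fun m ↦ ‖iteratedFDeriv ℝ m f (τ y)‖)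
        rw [Finset.card_range] at h
        refine h.trans (le_of_eq ?_)
        push_cast
        ring
      calc ‖iteratedFDeriv ℝ i (fun y ↦ ρ y • f (τ y)) y‖ₑ ^ 2
          = ENNReal.ofReal (‖iteratedFDeriv ℝ i (fun y ↦ ρ y • f (τ y)) y‖ ^ 2) := by
            rw [← ofReal_norm, ENNReal.ofReal_pow (norm_nonneg _)]
        _ ≤ ENNReal.ofReal (A ^ 2 * (i + 1) *
              ∑ m ∈ Finset.range (i + 1), ‖iteratedFDeriv ℝ m f (τ y)‖ ^ 2) :=
            ENNReal.ofReal_le_ofReal h2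
        _ = ENNReal.ofReal (A ^ 2 * (i + 1)) * Φ i (τ y) := by
            rw [ENNReal.ofReal_mul (by positivity), hΦ,
              ENNReal.ofReal_sum_of_nonneg (fun _ _ ↦ sq_nonneg _)]
            congr 1
            refine Finset.sum_congr rfl fun m _ ↦ ?_
            rw [← ofReal_norm, ENNReal.ofReal_pow (norm_nonneg _)]
    · rw [indicator_of_notMem hy, iteratedFDeriv_smul_comp_eq_zero hρK f τ i hy, ← ofReal_norm,
        norm_zero, ENNReal.ofReal_zero, zero_pow two_ne_zero]
  -- integrate, change variables, compare with `E_k(f)`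
  have hint : ∀ i ≤ k, ∫⁻ y, ‖iteratedFDeriv ℝ i (fun y ↦ ρ y • f (τ y)) y‖ₑ ^ 2 ≤
      B i * sobolevEnergy k f := by
    intro i hi
    calc ∫⁻ y, ‖iteratedFDeriv ℝ i (fun y ↦ ρ y • f (τ y)) y‖ₑ ^ 2
        ≤ ∫⁻ y, K.indicator (fun y ↦ ENNReal.ofReal (A ^ 2 * (i + 1)) * Φ i (τ y)) y :=
          lintegral_mono (hpt i hi)
      _ = ENNReal.ofReal (A ^ 2 * (i + 1)) * ∫⁻ y in K, Φ i (τ y) := by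
          rw [lintegral_indicator hK.measurableSet,
            lintegral_const_mul' _ _ ENNReal.ofReal_ne_top]
      _ ≤ ENNReal.ofReal (A ^ 2 * (i + 1)) * (c * ∫⁻ x, Φ i x) :=
          mul_le_mul' le_rfl (hc (Φ i))
      _ = ENNReal.ofReal (A ^ 2 * (i + 1)) *
            (c * ∑ m ∈ Finset.range (i + 1), ∫⁻ x, ‖iteratedFDeriv ℝ m f x‖ₑ ^ 2) := by
          rw [hΦ]
          congr 2
          exact lintegral_finsetSum _ fun m _ ↦ hΦmeas m
      _ ≤ ENNReal.ofReal (A ^ 2 * (i + 1)) *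
            (c * ∑ m ∈ Finset.range (i + 1), N' m * sobolevEnergy k f) := by
          refine mul_le_mul' le_rfl (mul_le_mul' le_rfl (Finset.sum_le_sum fun m hm ↦ ?_))
          have hmi : m ≤ i := Nat.lt_succ_iff.1 (Finset.mem_range.1 hm)
          exact (hN' m hf).trans (mul_le_mul' le_rfl (sobolevEnergy_mono (hmi.trans hi) f))
      _ = B i * sobolevEnergy k f := by
          rw [hB, ← Finset.sum_mul]
          simp only
          ring
  calc sobolevEnergy k (fun y ↦ ρ y • f (τ y))
      ≤ N * ∑ i ∈ Finset.range (k + 1),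
          ∫⁻ y, ‖iteratedFDeriv ℝ i (fun y ↦ ρ y • f (τ y)) y‖ₑ ^ 2 := hN hg
    _ ≤ N * ∑ i ∈ Finset.range (k + 1), B i * sobolevEnergy k f :=
        mul_le_mul' le_rfl (Finset.sum_le_sum fun i hi ↦
          hint i (Nat.lt_succ_iff.1 (Finset.mem_range.1 hi)))
    _ = N * (∑ i ∈ Finset.range (k + 1), B i) * sobolevEnergy k f := by
        rw [← Finset.sum_mul, mul_assoc]

end Transport

end Literature.Analysis.PDE

end
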